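import Literature.NumberTheory.Rogawski1990.CMLocalAPacketMembers
import Literature.NumberTheory.Automorphic.SmoothInductionSphericalLine
import Literature.NumberTheory.Automorphic.GLnCongruenceSubgroups
import Literature.NumberTheory.Automorphic.HaarConjCompact
import HarnessLib

/-!
# The unramified member of a maximal-parabolic induced representation of `GL_n(F)` is spherical:
# `i_{P_{(n-1,1)}}((ν₀ ∘ det) ⊠ χ′)^{GL_n(𝒪)}` is a line for unramified `ν₀, χ′` (Cartier §III.3, §IV.1; Rogawski §4.5, §12.2)

Topic `NumberTheory/Automorphic`; namespace `Literature.NumberTheory.Automorphic`.  PROOF FILE (theorems only; no definition, no named fact, no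
instance, no notation, no `sorry`).  The split-place input of the rung-4 «unramified constituent» (Hodge-CM programme, PLAN.F0P3g4 §24 Z7, (β)
currency): at a finite place `v` of `L⁺` split in `L`, `w ∣ v`, the single member `i_G(ξ_w) = (ν₀ ∘ det_{GL₂}) × χ′` of the local packet (★
`Rogawski1990.splitMemberGL`, irreducible by ★ `Zelevinsky1980.parabolicIndGL_detChar_unitary_isIrreducible_holds`) has a LINE of
`GL₃(𝒪_w)`-fixed vectors as soon as the labels `ν₀, χ′` are UNRAMIFIED (trivial on `𝒪_w^×`).  Proof = ★ `Representation.isSpherical_smoothIndRep`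
(`(Ind_P^G σ)^K ≅ W^{P ∩ K}` for `G = P·K`) with: the Iwasawa decomposition `GL_n(F) = B·GL_n(𝒪) ⊆ P·GL_n(𝒪)` (★ `exists_borel_mul_glInt`); the Levi
blocks of an element of `P ∩ GL_n(𝒪)` have UNIT determinants (its inverse is again block triangular and integral); and `δ_P^{1/2} = 1` on the COMPACT
subgroup `P ∩ GL_n(𝒪)` (★ `modularCharacter_eq_one_of_mem_isCompact`).

* §1 `standardParabolicGL_id_le_of_monotone` (Borel `≤ P_c` for monotone labels), `exists_parabolic_mul_glInt` (`GL_n = P_c · GL_n(𝒪)`).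
* §2 `valuation_det_leviProjection_eq_one` (Levi blocks of `p ∈ P_c ∩ GL_n(𝒪)` have unit determinant), `deltaChar_eq_one_of_mem_glInt`,
  `rootDeltaChar_eq_one_of_mem_glInt` (`δ_P`, `δ_P^{1/2}` are trivial on `P_c ∩ GL_n(𝒪)`).
* §3 `isSpherical_parabolicIndGL_maxParabolicLeviChar` (`i_{P_{(n-1,1)}}((ν₀∘det) ⊠ χ′)` is `GL_n(𝒪)`-spherical for unramified `ν₀, χ′`) and the
  packet form `isSpherical_splitMemberGL` (`n = 3`).

## References
* P. Cartier, *Representations of 𝔭-adic groups: a survey*, PSPM 33.1 (1979), §III.3, §IV.1 [CartierCorvallis1979].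
* J. Rogawski, *Automorphic Representations of Unitary Groups in Three Variables* (1990), §4.5 p. 45; §12.2 pp. 173–174; §13.1 p. 199 [Rogawski1990].
* D. Bump, *Automorphic Forms and Representations* (1997), Prop. 4.5.2 (Iwasawa decomposition) [Bump1997].
-/

set_option autoImplicit false

noncomputable section

open scoped Valued MatrixGroups NNReal
open MeasureTheory ValuativeRel

namespace Literature.NumberTheory.Automorphic

universe u

/-! ## §1 `GL_n(F) = P_c · GL_n(𝒪)` -/

section Iwasawa

variable {F : Type u} [Field F] [ValuativeRel F] {n : ℕ} {α : Type*} [LinearOrder α]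

omit [ValuativeRel F] in
/-- For a MONOTONE label `c : Fin n → α` the Borel subgroup (label `id`) is contained in `P_c`: an upper triangular matrix is block upper
triangular for any coarser increasing block structure. [cite: BernsteinZelevinsky1977, §2.1] -/
theorem standardParabolicGL_id_le_of_monotone {c : Fin n → α} (hc : Monotone c) :
    standardParabolicGL F (id : Fin n → Fin n) ≤ standardParabolicGL F c := by
  intro g hg
  rw [mem_standardParabolicGL_iff] at hg ⊢
  intro i j hij
  exact hg (lt_of_not_ge fun hle => (hc hle).not_gt hij)

/-- **`GL_n(F) = P_c · GL_n(𝒪)`** for a monotone label `c` (Iwasawa `GL_n = B·GL_n(𝒪)` ★ `exists_borel_mul_glInt` and `B ≤ P_c`).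
[cite: Bump1997, Prop. 4.5.2] [cite: CartierCorvallis1979, §III.3] -/
theorem exists_parabolic_mul_glInt {c : Fin n → α} (hc : Monotone c) (g : GL (Fin n) F) :
    ∃ p : standardParabolicGL F c, ∃ k ∈ glInt n F, g = (p : GL (Fin n) F) * k := by
  obtain ⟨b, hb, k, hk, hg⟩ := exists_borel_mul_glInt g
  exact ⟨⟨b, standardParabolicGL_id_le_of_monotone hc hb⟩, k, hk, hg⟩

end Iwasawa

/-! ## §2 Levi blocks and the modulus on `P_c ∩ GL_n(𝒪)` -/

section Levi

variable {F : Type u} [Field F] [ValuativeRel F] {n : ℕ} {α : Type*} [LinearOrder α] {c : Fin n → α}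

/-- **The Levi blocks of `p ∈ P_c ∩ GL_n(𝒪)` have unit determinant**: the block of `p` and the block of `p⁻¹` (= the inverse block, ★
`leviProjection` is multiplicative) are integral, so both determinants are integral and their product is `1`. [cite: BernsteinZelevinsky1977, §2.1] -/
theorem valuation_det_leviProjection_eq_one (p : standardParabolicGL F c) (hp : (p : GL (Fin n) F) ∈ glInt n F) (a : α) :
    valuation F ((leviProjection F c p a : GL {i // c i = a} F) : Matrix {i // c i = a} {i // c i = a} F).det = 1 := by
  classical
  obtain ⟨hint, hinv⟩ := (mem_glInt_iff _).1 hp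
  have hint' : ∀ i j : {i // c i = a}, ((leviProjection F c p a : GL {i // c i = a} F) : Matrix {i // c i = a} {i // c i = a} F) i j ∈ 𝒪[F] :=
    fun i j => by rw [leviProjection_apply_coe]; exact hint _ _
  have hinv' : ∀ i j : {i // c i = a}, (((leviProjection F c p a)⁻¹ : GL {i // c i = a} F) : Matrix {i // c i = a} {i // c i = a} F) i j ∈ 𝒪[F] := by
    intro i j
    rw [← Pi.inv_apply, ← map_inv, leviProjection_apply_coe, Subgroup.coe_inv]
    exact hinv _ _
  have h1 : valuation F ((leviProjection F c p a : GL {i // c i = a} F) : Matrix {i // c i = a} {i // c i = a} F).det ≤ 1 :=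
    valuation_det_le_one fun i j => (Valuation.mem_integer_iff _ _).1 (hint' i j)
  have h2 : valuation F (((leviProjection F c p a)⁻¹ : GL {i // c i = a} F) : Matrix {i // c i = a} {i // c i = a} F).det ≤ 1 :=
    valuation_det_le_one fun i j => (Valuation.mem_integer_iff _ _).1 (hinv' i j)
  have hprod : valuation F ((leviProjection F c p a : GL {i // c i = a} F) : Matrix {i // c i = a} {i // c i = a} F).det *
      valuation F (((leviProjection F c p a)⁻¹ : GL {i // c i = a} F) : Matrix {i // c i = a} {i // c i = a} F).det = 1 := by
    rw [← map_mul, ← Matrix.det_mul, ← Units.val_mul, mul_inv_cancel, Units.val_one, Matrix.det_one, map_one]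
  refine le_antisymm h1 ?_
  calc (1 : ValueGroupWithZero F)
      = valuation F ((leviProjection F c p a : GL {i // c i = a} F) : Matrix {i // c i = a} {i // c i = a} F).det *
          valuation F (((leviProjection F c p a)⁻¹ : GL {i // c i = a} F) : Matrix {i // c i = a} {i // c i = a} F).det := hprod.symm
    _ ≤ valuation F ((leviProjection F c p a : GL {i // c i = a} F) : Matrix {i // c i = a} {i // c i = a} F).det * 1 := mul_le_mul' le_rfl h2
    _ = _ := mul_one _

variable [TopologicalSpace F] [IsNonarchimedeanLocalField F] [LocallyCompactSpace (standardParabolicGL F c)]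

/-- **`δ_{P_c} = 1` on `P_c ∩ GL_n(𝒪)`**: the modulus of a locally compact group is trivial on every compact subgroup (★
`modularCharacter_eq_one_of_mem_isCompact`), and `P_c ∩ GL_n(𝒪)` is compact in `P_c` (`P_c` closed ★ `isClosed_standardParabolicGL`, `GL_n(𝒪)`
compact ★ `isCompact_glInt`). [cite: CartierCorvallis1979, §III.3] [cite: BernsteinZelevinsky1977, 1.7] -/
theorem deltaChar_eq_one_of_mem_glInt (p : standardParabolicGL F c) (hp : (p : GL (Fin n) F) ∈ glInt n F) :
    deltaChar (standardParabolicGL F c) p = 1 := by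
  letI : MeasurableSpace (standardParabolicGL F c) := borel _
  haveI : BorelSpace (standardParabolicGL F c) := ⟨rfl⟩
  have hK : IsCompact (((glInt n F).comap (standardParabolicGL F c).subtype : Subgroup (standardParabolicGL F c)) :
      Set (standardParabolicGL F c)) :=
    (isClosed_standardParabolicGL F c).isClosedEmbedding_subtypeVal.isCompact_preimage (isCompact_glInt n F)
  have h := modularCharacter_eq_one_of_mem_isCompact hK (k := p) hp
  refine Units.ext ?_
  rw [deltaChar_apply, h]
  simp

/-- **`δ_{P_c}^{1/2} = 1` on `P_c ∩ GL_n(𝒪)`**. [cite: CartierCorvallis1979, §III.3] [cite: BernsteinZelevinsky1977, 1.7 and §2.3] -/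
theorem rootDeltaChar_eq_one_of_mem_glInt (p : standardParabolicGL F c) (hp : (p : GL (Fin n) F) ∈ glInt n F) :
    rootDeltaChar (standardParabolicGL F c) p = 1 :=
  rootDeltaChar_eq_one_of_deltaChar_eq_one _ (deltaChar_eq_one_of_mem_glInt p hp)

end Levi

/-! ## §3 The unramified maximal-parabolic induced representation is spherical -/

section Spherical

variable (F : Type) [Field F] [ValuativeRel F] [TopologicalSpace F] [IsNonarchimedeanLocalField F] (N : ℕ)
  [LocallyCompactSpace (standardParabolicGL F (Zelevinsky1980.lastBlockLabel N))]

/-- The label `lastBlockLabel N` (`i ↦ (N ≤ i + 1)`) is monotone. [cite: Zelevinsky1980, §1.1, p. 170] -/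
theorem monotone_lastBlockLabel : Monotone (Zelevinsky1980.lastBlockLabel N) := by
  intro i j hij
  simp only [Zelevinsky1980.lastBlockLabel_apply]
  by_cases h : N ≤ (i : ℕ) + 1
  · have h' : N ≤ (j : ℕ) + 1 := h.trans (by have := hij; simp only [Fin.le_def] at this; omega)
    rw [decide_eq_true h, decide_eq_true h']
  · rw [decide_eq_false h]
    exact Bool.false_le _

/-- **`i_{P_{(N-1,1)}}((ν₀ ∘ det) ⊠ χ′)` IS `GL_N(𝒪)`-SPHERICAL FOR UNRAMIFIED `ν₀, χ′`** (trivial on the units of valuation `1`): its `GL_N(𝒪)`-fixed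
vectors form a line. [cite: CartierCorvallis1979, §IV.1] [cite: Rogawski1990, §4.5 p. 45; §12.2 pp. 173–174] -/
theorem isSpherical_parabolicIndGL_maxParabolicLeviChar (ν₀ χ' : Fˣ →* ℂˣ)
    (hν₀ : ∀ u : Fˣ, valuation F (u : F) = 1 → ν₀ u = 1) (hχ' : ∀ u : Fˣ, valuation F (u : F) = 1 → χ' u = 1) :
    (Representation.parabolicIndGL F (Zelevinsky1980.lastBlockLabel N)
      ((Representation.trivial ℂ (Π a : Bool, GL {i : Fin N // Zelevinsky1980.lastBlockLabel N i = a} F) ℂ).twist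
        (Zelevinsky1980.maxParabolicLeviChar F N ν₀ χ'))).IsSpherical (glInt N F) := by
  refine Representation.isSpherical_smoothIndRep _ (isOpen_glInt N F) (fun g => ?_) (Module.finrank_self ℂ) fun p hp => ?_
  · obtain ⟨p, k, hk, hg⟩ := exists_parabolic_mul_glInt (monotone_lastBlockLabel N) g
    exact ⟨p, k, hk, hg⟩
  · -- the twisted character is trivial at `p ∈ P ∩ GL_N(𝒪)`: both Levi determinants are units and `δ^{1/2}(p) = 1`
    apply LinearMap.ext
    intro z
    rw [Representation.twist_apply, rootDeltaChar_eq_one_of_mem_glInt p hp, Units.val_one, one_smul, MonoidHom.comp_apply,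
      Representation.twist_apply, Zelevinsky1980.maxParabolicLeviChar_apply, Module.End.one_apply]
    have hdet : ∀ a : Bool, valuation F ((Matrix.GeneralLinearGroup.det (leviProjection F _ p a) : Fˣ) : F) = 1 := fun a => by
      rw [Matrix.GeneralLinearGroup.val_det_apply]
      exact valuation_det_leviProjection_eq_one p hp a
    rw [hν₀ _ (hdet false), hχ' _ (hdet true), one_mul, Units.val_one, one_smul]
    rfl

/-- **The split packet member `i_G(ξ_w)` is `GL₃(𝒪_w)`-spherical for unramified labels** (★ `Rogawski1990.splitMemberGL`, `N = 3`).
[cite: Rogawski1990, §13.1 p. 199; §12.2 pp. 173–174; §4.5 p. 45] [cite: CartierCorvallis1979, §IV.1] -/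
theorem isSpherical_splitMemberGL [LocallyCompactSpace (standardParabolicGL F (Zelevinsky1980.lastBlockLabel 3))] (ν₀ χ' : Fˣ →* ℂˣ)
    (hν₀u : ∀ x, ‖((ν₀ x : ℂˣ) : ℂ)‖ = 1) (hν₀c : Continuous fun x => ((ν₀ x : ℂˣ) : ℂ)) (hχ'u : ∀ x, ‖((χ' x : ℂˣ) : ℂ)‖ = 1)
    (hχ'c : Continuous fun x => ((χ' x : ℂˣ) : ℂ))
    (hν₀ : ∀ u : Fˣ, valuation F (u : F) = 1 → ν₀ u = 1) (hχ' : ∀ u : Fˣ, valuation F (u : F) = 1 → χ' u = 1) :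
    (Rogawski1990.splitMemberGL F ν₀ χ' hν₀u hν₀c hχ'u hχ'c).ρ.IsSpherical (glInt 3 F) :=
  isSpherical_parabolicIndGL_maxParabolicLeviChar F 3 ν₀ χ' hν₀ hχ'

end Spherical

end Literature.NumberTheory.Automorphic

end
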